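import Summits.CriticalPhenomena.PercolationContinuityZ3.Theorems.PercNearOneGluingNoHeavyLowerTailKnQuestion8AntitheticCubeCharge
import HarnessLib

/-!
# Antithetic Harris inequalities on the cube (BENCH rows M2-R93/M2-R95, PROOFS §P68 (b)(i), (j))

Support file (`--supports stmt-CriticalPhenomena-4575`), prover seat `prim-rate-mine-2` (lane prim-rate, constants-miner (c);
`run/shared/lean/prim/prim-rate/prim-rate-mine-2/PROOFS.md` §P68).  No definitions, no named facts, no sorries; standard axioms; Mathlib only.

SETTING.  Families `𝒜, ℬ` of subsets of a finite type `α` («configurations»; a set `s` and its COMPLEMENT `sᶜ` are the red and the blue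
pair sets of the p = ½ complementary = antithetic coupling of PROOFS §P68).  For UP-SETS `𝒜, ℬ`:

* `CSH.card_filter_compl_mem_le_card_inter` — **`#{s ∈ 𝒜 : sᶜ ∈ ℬ} ≤ #(𝒜 ∩ ℬ)`**: an increasing event of `s` and an increasing event
  of `sᶜ` are negatively correlated relative to the same two events of `s` (Harris–Kleitman twice: `2ⁿ·#(𝒜 ∩ ℬᶜˢ) ≤ #𝒜·#ℬᶜˢ = #𝒜·#ℬ ≤ 2ⁿ·#(𝒜 ∩ ℬ)`,
  `ℬᶜˢ = {s : sᶜ ∈ ℬ}` being a down-set).  This is the sign `S(H) ≥ 0` of the C-slope of the antithetic size-law functional (§P68 (b)(i)) and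
  the non-negativity of the antithetic readings of the side covariances φ, d, E, H (§P68 (j)).
* `CSH.card_antithetic_discordant_le` — **`#{s ∈ 𝒜 ∖ ℬ : sᶜ ∈ ℬ ∖ 𝒜} ≤ #{s ∉ 𝒜 ∪ ℬ : sᶜ ∈ 𝒜 ∩ ℬ}`** (the WEAK ANTITHETIC GADGET-HARRIS
  inequality of §P68 (j): with `𝒜 = {a↔b}`, `ℬ = {a↔u}` it reads `Q[ab,au] ≤ Q[0,abu] + Q[bu,abu]`).  PROOF: with the dual up-sets
  `𝒜* := {s : sᶜ ∉ 𝒜}`, the left side is `#{s ∈ 𝒜 ∩ 𝒜* : sᶜ ∈ ℬ ∩ ℬ*}`, the first lemma bounds it by `#(𝒜 ∩ 𝒜* ∩ ℬ ∩ ℬ*)`, and `s ↦ sᶜ`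
  maps that set onto the right side.
RELATION TO THE TREE.  The antithetic vdBHK programme of the seats `prim-hp-2` / `prim-ineq-gen-7` (files `…Antithetic*`, `…Antipodal*`,
`…KnQuestion8Antithetic*`) has the Harris layer in cluster-function form (`Antithetic.antithetic_harris`, `Antithetic.cross_le_same_harris`) and
the Kleitman consequences `AntitheticCube.card_inter_le_card_compls_inter` / `cube_charge`; this file reuses `AntitheticCube.isUpperSet_compls`,
`SahiGridPattern.isLowerSet_compls` and adds the two finset-family statements the size-law (S1) programme of lane prim-rate needs verbatim.
[cite: Harris1960, Lemma 4.1 (p. 16)] [cite: AhlswedeDaykin1978, Thm. 1 (p. 183)]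
-/

namespace Summit.CriticalPhenomena.PercolationContinuityZ3.Theorems.CSH

open Finset
open scoped FinsetFamily

variable {α : Type*} [Fintype α] [DecidableEq α]

/-- **Antithetic Harris**: for up-sets `𝒜, ℬ` of subsets of a finite type, `#{s ∈ 𝒜 : sᶜ ∈ ℬ} ≤ #(𝒜 ∩ ℬ)` —
an increasing event of a uniform random subset and an increasing event of its complement are no more correlated than the two
events of the subset itself (Harris–Kleitman applied twice). [cite: Harris1960, Lemma 4.1 (p. 16)] -/
theorem card_filter_compl_mem_le_card_inter {𝒜 ℬ : Finset (Finset α)}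
    (h𝒜 : IsUpperSet (𝒜 : Set (Finset α))) (hℬ : IsUpperSet (ℬ : Set (Finset α))) :
    #(𝒜.filter fun s => sᶜ ∈ ℬ) ≤ #(𝒜 ∩ ℬ) := by
  have hfilter : (𝒜.filter fun s => sᶜ ∈ ℬ) = 𝒜 ∩ ℬᶜˢ := by
    ext s; simp [mem_compls]
  rw [hfilter]
  have h1 : 2 ^ Fintype.card α * #(𝒜 ∩ ℬᶜˢ) ≤ #𝒜 * #(ℬᶜˢ) :=
    h𝒜.card_inter_le_finset (SahiGridPattern.isLowerSet_compls hℬ)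
  have h2 : #𝒜 * #ℬ ≤ 2 ^ Fintype.card α * #(𝒜 ∩ ℬ) := h𝒜.le_card_inter_finset hℬ
  rw [card_compls] at h1
  have hpos : 0 < 2 ^ Fintype.card α := Nat.two_pow_pos _
  exact Nat.le_of_mul_le_mul_left (h1.trans h2) hpos

/-- **The weak antithetic gadget-Harris inequality** (PROOFS §P68 (j)): for up-sets `𝒜, ℬ`,
`#{s ∈ 𝒜 ∖ ℬ : sᶜ ∈ ℬ ∖ 𝒜} ≤ #{s ∉ 𝒜 ∪ ℬ : sᶜ ∈ 𝒜 ∩ ℬ}` — discordant antithetic pairs are outnumbered by the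
«red none / blue both» pairs.  Via the dual up-sets `{s : sᶜ ∉ 𝒜}`. [cite: Harris1960, Lemma 4.1 (p. 16)] -/
theorem card_antithetic_discordant_le {𝒜 ℬ : Finset (Finset α)}
    (h𝒜 : IsUpperSet (𝒜 : Set (Finset α))) (hℬ : IsUpperSet (ℬ : Set (Finset α))) :
    #((univ : Finset (Finset α)).filter fun s => s ∈ 𝒜 ∧ s ∉ ℬ ∧ sᶜ ∈ ℬ ∧ sᶜ ∉ 𝒜)
      ≤ #((univ : Finset (Finset α)).filter fun s => s ∉ 𝒜 ∧ s ∉ ℬ ∧ sᶜ ∈ 𝒜 ∧ sᶜ ∈ ℬ) := by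
  -- dual up-sets
  set 𝒜' : Finset (Finset α) := (univ \ 𝒜)ᶜˢ with h𝒜'
  set ℬ' : Finset (Finset α) := (univ \ ℬ)ᶜˢ with hℬ'
  have mem𝒜' : ∀ s, s ∈ 𝒜' ↔ sᶜ ∉ 𝒜 := fun s => by simp [h𝒜', mem_compls]
  have memℬ' : ∀ s, s ∈ ℬ' ↔ sᶜ ∉ ℬ := fun s => by simp [hℬ', mem_compls]
  have low𝒜c : IsLowerSet ((univ \ 𝒜 : Finset (Finset α)) : Set (Finset α)) := by
    intro s t hts hs
    rw [Finset.mem_coe, mem_sdiff] at hs ⊢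
    exact ⟨mem_univ _, fun ht => hs.2 (h𝒜 hts ht)⟩
  have lowℬc : IsLowerSet ((univ \ ℬ : Finset (Finset α)) : Set (Finset α)) := by
    intro s t hts hs
    rw [Finset.mem_coe, mem_sdiff] at hs ⊢
    exact ⟨mem_univ _, fun ht => hs.2 (hℬ hts ht)⟩
  have up𝒜' : IsUpperSet (𝒜' : Set (Finset α)) := AntitheticCube.isUpperSet_compls low𝒜c
  have upℬ' : IsUpperSet (ℬ' : Set (Finset α)) := AntitheticCube.isUpperSet_compls lowℬc
  have upU : IsUpperSet ((𝒜 ∩ 𝒜' : Finset (Finset α)) : Set (Finset α)) := by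
    rw [coe_inter]; exact h𝒜.inter up𝒜'
  have upW : IsUpperSet ((ℬ ∩ ℬ' : Finset (Finset α)) : Set (Finset α)) := by
    rw [coe_inter]; exact hℬ.inter upℬ'
  -- the left side is #{s ∈ U : sᶜ ∈ W}
  have hL : ((univ : Finset (Finset α)).filter fun s => s ∈ 𝒜 ∧ s ∉ ℬ ∧ sᶜ ∈ ℬ ∧ sᶜ ∉ 𝒜)
      = (𝒜 ∩ 𝒜').filter fun s => sᶜ ∈ ℬ ∩ ℬ' := by
    ext s
    simp only [mem_filter, mem_univ, true_and, mem_inter, mem𝒜', memℬ', compl_compl]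
    tauto
  -- the right side is the image under complement of U ∩ W
  have hR : ((univ : Finset (Finset α)).filter fun s => s ∉ 𝒜 ∧ s ∉ ℬ ∧ sᶜ ∈ 𝒜 ∧ sᶜ ∈ ℬ)
      = ((𝒜 ∩ 𝒜') ∩ (ℬ ∩ ℬ'))ᶜˢ := by
    ext s
    simp only [mem_filter, mem_univ, true_and, mem_compls, mem_inter, mem𝒜', memℬ', compl_compl]
    tauto
  rw [hL, hR, card_compls]
  exact card_filter_compl_mem_le_card_inter upU upW

end Summit.CriticalPhenomena.PercolationContinuityZ3.Theorems.CSH
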